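import Summits.Langlands.Langlands.Theorems.PicardMuOrdinaryMuOrdinaryFamilyRTCharZeroReduction
import Summits.Langlands.Langlands.Theorems.MuOrdinaryFamilyRT.Negative.AccumulationDominance
import Summits.Langlands.Langlands.Theorems.MuOrdinaryFamilyRT.Negative.AccumulationNormality
import Summits.Langlands.Langlands.Theorems.MuOrdinaryFamilyRT.Negative.AccumulateRegularity
import Summits.Langlands.Langlands.Theorems.MuOrdinaryFamilyRT.Negative.SepRedundant
import Summits.Langlands.Langlands.Theorems.MuOrdinaryFamilyRT.Negative.CongruenceEncoding
import Summits.Langlands.Langlands.Theorems.MuOrdinaryFamilyRT.Negative.GenericClass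
import Summits.Langlands.Langlands.Theorems.MuOrdinaryFamilyRT.Negative.ZariskiVsPadicDensity
import Summits.Langlands.Langlands.Theorems.MuOrdinaryFamilyRT.Negative.InertPrimeSquares
import Summits.Langlands.Langlands.Theorems.MuOrdinaryFamilyRT.Negative.ScopeVacuity
import Summits.Langlands.Langlands.Theorems.MuOrdinaryFamilyRT.Negative.ConjSelfDualShadow
import HarnessLib

/-!
# Line `char-zero-dominance` — skeleton v4 (fourth lead prover-line-stmt-Langlands-13757-c2-0)
# for the crux `Summit.Langlands.Langlands.Theses.PicardMuOrdinary.MuOrdinaryFamilyRT` (stmt-Langlands-13757)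

Everything of this line that is provable from the tree has LANDED (leads b-0, c1):
* vocabulary, `OrdFamily`, dominance lemma `algebraMap_injective_of_ringKrullDim_le`, statements of the open stubs:
  `Theorems/PicardMuOrdinaryMuOrdinaryFamilyRTCharZeroDefs.lean` (p111741);
* the composition `MuOrdinaryFamilyRT_of` / `MuOrdinaryFamilyRT_of_facts`:
  `Theorems/PicardMuOrdinaryMuOrdinaryFamilyRTCharZeroReduction.lean` (p112063);
* the landed stubs it feeds: `stub_accumulation` (p85419), `stub_dictionary` (p85480), `stub_picardInput_of` (p86963,
  conditional on `picardCurve_exists_lambdaAdicRep`), `stub_quadraticDescent_of` (p90012 + Clifford p88885, conditional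
  on five automorphic facts), weight-algebra dimension (p84973).

What remains open is exactly the five `sorry`s below: K2 `stub_charZeroFamily`, K1 `stub_definiteHost` (REPAIRED by c1:
hypothesis `4 ≤ ringKrullDim 𝓕.R`), the conceded complement `stub_remainder`, and the two Literature fact debts
`stub_picardFact`, `stub_descentFacts`.  `MuOrdinaryFamilyRT_proof` concludes the crux BY NAME from them through the landed
`MuOrdinaryFamilyRT_of_facts`.  The ten `Negative/*` imports are the standing disprover's load-bearing lemmas (tests every
stub statement survives: dominance p74393, normality p74844, `eT` p77215, scope vacuity F12, congruence traps F3).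
-/

set_option linter.dupNamespace false

namespace Summit.Langlands.Langlands.Cruxes.MuOrdinaryFamilyRT.CharZeroDominance

open scoped NumberField Polynomial Matrix Classical
open Field IsDedekindDomain Polynomial
open Literature.NumberTheory.GaloisRepresentations Literature.NumberTheory.Automorphic

noncomputable section

/-- K2 (THE LEVER): for generic `f` with `ρ_C` μ-ordinary at `3`, an integral B-ordinary polarized `Λ`-adic family
through `ρ_C` of Krull dimension `≥ 4` (the characteristic-zero Poitou–Tate count at `x_C`; Kisin 2008 §2.3,
Allen arXiv:1411.7661, Geraghty 2019 §3).  OPEN — blocked on absent Literature (report `stub_charZeroFamily_report.md`). -/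
theorem stub_charZeroFamily : S.stub_charZeroFamily := by
  sorry

/-- K1 (THE HOST, hardest): every such family of dimension `≥ 4` is finite over its weight algebra and its arithmetic
points near `x_C` are classical over `F' = K(√d)` — a `Λ`-adic ordinary `R^{red} = T` theorem for the definite `U(3)`
at the split prime `3` with `p = n = 3`, `ζ₃ ∈ F'`, image `S₄`: outside every printed hypothesis (Thorne 2012,
Geraghty 2019, BLGGT 2014, CHT 2008).  OPEN — research-sized (analysis `stub_definiteHost_analysis.md`). -/
theorem stub_definiteHost : S.stub_definiteHost := by
  sorry

/-- The conceded complement (NOT a lemma of the line): the crux verbatim for `(f, ρ_C)` outside the main class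
(`ρ_C` not μ-ordinary at `3`, or image `A₄`). -/
theorem stub_remainder : S.stub_remainder := by
  sorry

/-- FACT STUB A: the `λ`-adic representation of a Picard curve exists (named fact
`picardCurve_exists_lambdaAdicRep`; needs étale `H¹` of curves — absent from the tree). -/
theorem stub_picardFact : S.stub_picardFact := by
  sorry

/-- FACT STUB B: Arthur–Clozel strong lifting (unramified, archimedean), cyclic cuspidal descent, existence of
infinity types, and `exists_galoisRep_of_regularAlgebraic` (HLTT/Scholze) — named automorphic facts of the tree. -/
theorem stub_descentFacts : S.stub_descentFacts := by
  sorry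

/-- **The crux from the five stubs** (composition = the landed `MuOrdinaryFamilyRT_of_facts`, p112063). -/
theorem MuOrdinaryFamilyRT_proof : Summit.Langlands.Langlands.Theses.PicardMuOrdinary.MuOrdinaryFamilyRT :=
  MuOrdinaryFamilyRT_of_facts stub_picardFact stub_charZeroFamily stub_definiteHost stub_descentFacts stub_remainder

/-! ### Disprover tests the statements survive (load-bearing lemmas, imported from `Negative/`) -/

example := @Summit.Langlands.Langlands.Theorems.MuOrdinaryFamilyRT.Negative.stub_accumulation_false_without_dominance
example := @Summit.Langlands.Langlands.Theorems.MuOrdinaryFamilyRT.Negative.stub_accumulation_false_without_normality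
example := @Summit.Langlands.Langlands.Theorems.MuOrdinaryFamilyRT.Negative.stub_accumulate_false_without_eT
example := @Summit.Langlands.Langlands.Theorems.MuOrdinaryFamilyRT.Negative.muOrdinaryFamilyRT_iff_remainder

end

end Summit.Langlands.Langlands.Cruxes.MuOrdinaryFamilyRT.CharZeroDominance
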